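import Mathlib.NumberTheory.Divisors
import Mathlib.Tactic.Ring
import Mathlib.Tactic.NormNum
import HarnessLib

/-!
# Cube part sizes at `|A| = 484, 847` (`ℤ_11²` quotient): ordered factorisations of `(|A| − 1)/3` (arithmetic for `DihedralLawModOneZ11Z11Orders`)

ω-census `pub-omega`, family (b3), seat pub-omega-group gen 38.  Framing: lottery ticket; floor = certified bounds/negative ranges.
VALUE: bookkeeping (pure arithmetic); NOT progress on ω.
-/

namespace Summit.MatrixMultiplication.OmegaCensus

/-- The cube part sizes at `|A| = 484`: `cde = 161`, all `9` ordered factorisations. [folklore] -/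
theorem cube_factor_of_484 {c d e : ℕ} (h : 3 * (c * d * e) + 1 = 484) :
    (c = 1 ∧ d = 1 ∧ e = 161) ∨
      (c = 1 ∧ d = 7 ∧ e = 23) ∨
      (c = 1 ∧ d = 23 ∧ e = 7) ∨
      (c = 1 ∧ d = 161 ∧ e = 1) ∨
      (c = 7 ∧ d = 1 ∧ e = 23) ∨
      (c = 7 ∧ d = 23 ∧ e = 1) ∨
      (c = 23 ∧ d = 1 ∧ e = 7) ∨
      (c = 23 ∧ d = 7 ∧ e = 1) ∨
      (c = 161 ∧ d = 1 ∧ e = 1) := by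
  have hcde : c * (d * e) = 161 := by rw [← mul_assoc]; omega
  have hc : c ∈ Nat.divisors 161 := Nat.mem_divisors.2 ⟨Dvd.intro _ hcde, by norm_num⟩
  have hd : d ∈ Nat.divisors 161 :=
    Nat.mem_divisors.2 ⟨Dvd.intro (c * e) (by rw [← hcde]; ring), by norm_num⟩
  rw [show Nat.divisors 161 = {1, 7, 23, 161} from by decide] at hc hd
  simp only [Finset.mem_insert, Finset.mem_singleton] at hc hd
  rcases hc with rfl | rfl | rfl | rfl <;> rcases hd with rfl | rfl | rfl | rfl
  · have he : e = 161 := by omega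
    exact Or.inl ⟨rfl, rfl, he⟩
  · have he : e = 23 := by omega
    exact Or.inr (Or.inl ⟨rfl, rfl, he⟩)
  · have he : e = 7 := by omega
    exact Or.inr (Or.inr (Or.inl ⟨rfl, rfl, he⟩))
  · have he : e = 1 := by omega
    exact Or.inr (Or.inr (Or.inr (Or.inl ⟨rfl, rfl, he⟩)))
  · have he : e = 23 := by omega
    exact Or.inr (Or.inr (Or.inr (Or.inr (Or.inl ⟨rfl, rfl, he⟩))))
  · omega
  · have he : e = 1 := by omega
    exact Or.inr (Or.inr (Or.inr (Or.inr (Or.inr (Or.inl ⟨rfl, rfl, he⟩)))))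
  · omega
  · have he : e = 7 := by omega
    exact Or.inr (Or.inr (Or.inr (Or.inr (Or.inr (Or.inr (Or.inl ⟨rfl, rfl, he⟩))))))
  · have he : e = 1 := by omega
    exact Or.inr (Or.inr (Or.inr (Or.inr (Or.inr (Or.inr (Or.inr (Or.inl ⟨rfl, rfl, he⟩)))))))
  · omega
  · omega
  · have he : e = 1 := by omega
    exact Or.inr (Or.inr (Or.inr (Or.inr (Or.inr (Or.inr (Or.inr (Or.inr (⟨rfl, rfl, he⟩))))))))
  · omega
  · omega
  · omega

/-- The cube part sizes at `|A| = 847`: `cde = 282`, all `27` ordered factorisations. [folklore] -/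
theorem cube_factor_of_847 {c d e : ℕ} (h : 3 * (c * d * e) + 1 = 847) :
    (c = 1 ∧ d = 1 ∧ e = 282) ∨
      (c = 1 ∧ d = 2 ∧ e = 141) ∨
      (c = 1 ∧ d = 3 ∧ e = 94) ∨
      (c = 1 ∧ d = 6 ∧ e = 47) ∨
      (c = 1 ∧ d = 47 ∧ e = 6) ∨
      (c = 1 ∧ d = 94 ∧ e = 3) ∨
      (c = 1 ∧ d = 141 ∧ e = 2) ∨
      (c = 1 ∧ d = 282 ∧ e = 1) ∨
      (c = 2 ∧ d = 1 ∧ e = 141) ∨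
      (c = 2 ∧ d = 3 ∧ e = 47) ∨
      (c = 2 ∧ d = 47 ∧ e = 3) ∨
      (c = 2 ∧ d = 141 ∧ e = 1) ∨
      (c = 3 ∧ d = 1 ∧ e = 94) ∨
      (c = 3 ∧ d = 2 ∧ e = 47) ∨
      (c = 3 ∧ d = 47 ∧ e = 2) ∨
      (c = 3 ∧ d = 94 ∧ e = 1) ∨
      (c = 6 ∧ d = 1 ∧ e = 47) ∨
      (c = 6 ∧ d = 47 ∧ e = 1) ∨
      (c = 47 ∧ d = 1 ∧ e = 6) ∨
      (c = 47 ∧ d = 2 ∧ e = 3) ∨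
      (c = 47 ∧ d = 3 ∧ e = 2) ∨
      (c = 47 ∧ d = 6 ∧ e = 1) ∨
      (c = 94 ∧ d = 1 ∧ e = 3) ∨
      (c = 94 ∧ d = 3 ∧ e = 1) ∨
      (c = 141 ∧ d = 1 ∧ e = 2) ∨
      (c = 141 ∧ d = 2 ∧ e = 1) ∨
      (c = 282 ∧ d = 1 ∧ e = 1) := by
  have hcde : c * (d * e) = 282 := by rw [← mul_assoc]; omega
  have hc : c ∈ Nat.divisors 282 := Nat.mem_divisors.2 ⟨Dvd.intro _ hcde, by norm_num⟩
  have hd : d ∈ Nat.divisors 282 :=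
    Nat.mem_divisors.2 ⟨Dvd.intro (c * e) (by rw [← hcde]; ring), by norm_num⟩
  rw [show Nat.divisors 282 = {1, 2, 3, 6, 47, 94, 141, 282} from by decide] at hc hd
  simp only [Finset.mem_insert, Finset.mem_singleton] at hc hd
  rcases hc with rfl | rfl | rfl | rfl | rfl | rfl | rfl | rfl <;> rcases hd with rfl | rfl | rfl | rfl | rfl | rfl | rfl | rfl
  · have he : e = 282 := by omega
    exact Or.inl ⟨rfl, rfl, he⟩
  · have he : e = 141 := by omega
    exact Or.inr (Or.inl ⟨rfl, rfl, he⟩)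
  · have he : e = 94 := by omega
    exact Or.inr (Or.inr (Or.inl ⟨rfl, rfl, he⟩))
  · have he : e = 47 := by omega
    exact Or.inr (Or.inr (Or.inr (Or.inl ⟨rfl, rfl, he⟩)))
  · have he : e = 6 := by omega
    exact Or.inr (Or.inr (Or.inr (Or.inr (Or.inl ⟨rfl, rfl, he⟩))))
  · have he : e = 3 := by omega
    exact Or.inr (Or.inr (Or.inr (Or.inr (Or.inr (Or.inl ⟨rfl, rfl, he⟩)))))
  · have he : e = 2 := by omega
    exact Or.inr (Or.inr (Or.inr (Or.inr (Or.inr (Or.inr (Or.inl ⟨rfl, rfl, he⟩))))))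
  · have he : e = 1 := by omega
    exact Or.inr (Or.inr (Or.inr (Or.inr (Or.inr (Or.inr (Or.inr (Or.inl ⟨rfl, rfl, he⟩)))))))
  · have he : e = 141 := by omega
    exact Or.inr (Or.inr (Or.inr (Or.inr (Or.inr (Or.inr (Or.inr (Or.inr (Or.inl ⟨rfl, rfl, he⟩))))))))
  · omega
  · have he : e = 47 := by omega
    exact Or.inr (Or.inr (Or.inr (Or.inr (Or.inr (Or.inr (Or.inr (Or.inr (Or.inr (Or.inl ⟨rfl, rfl, he⟩)))))))))
  · omega
  · have he : e = 3 := by omega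
    exact Or.inr (Or.inr (Or.inr (Or.inr (Or.inr (Or.inr (Or.inr (Or.inr (Or.inr (Or.inr (Or.inl ⟨rfl, rfl, he⟩))))))))))
  · omega
  · have he : e = 1 := by omega
    exact Or.inr (Or.inr (Or.inr (Or.inr (Or.inr (Or.inr (Or.inr (Or.inr (Or.inr (Or.inr (Or.inr (Or.inl ⟨rfl, rfl, he⟩)))))))))))
  · omega
  · have he : e = 94 := by omega
    exact Or.inr (Or.inr (Or.inr (Or.inr (Or.inr (Or.inr (Or.inr (Or.inr (Or.inr (Or.inr (Or.inr (Or.inr (Or.inl ⟨rfl, rfl, he⟩))))))))))))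
  · have he : e = 47 := by omega
    exact Or.inr (Or.inr (Or.inr (Or.inr (Or.inr (Or.inr (Or.inr (Or.inr (Or.inr (Or.inr (Or.inr (Or.inr (Or.inr (Or.inl ⟨rfl, rfl, he⟩)))))))))))))
  · omega
  · omega
  · have he : e = 2 := by omega
    exact Or.inr (Or.inr (Or.inr (Or.inr (Or.inr (Or.inr (Or.inr (Or.inr (Or.inr (Or.inr (Or.inr (Or.inr (Or.inr (Or.inr (Or.inl ⟨rfl, rfl, he⟩))))))))))))))
  · have he : e = 1 := by omega
    exact Or.inr (Or.inr (Or.inr (Or.inr (Or.inr (Or.inr (Or.inr (Or.inr (Or.inr (Or.inr (Or.inr (Or.inr (Or.inr (Or.inr (Or.inr (Or.inl ⟨rfl, rfl, he⟩)))))))))))))))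
  · omega
  · omega
  · have he : e = 47 := by omega
    exact Or.inr (Or.inr (Or.inr (Or.inr (Or.inr (Or.inr (Or.inr (Or.inr (Or.inr (Or.inr (Or.inr (Or.inr (Or.inr (Or.inr (Or.inr (Or.inr (Or.inl ⟨rfl, rfl, he⟩))))))))))))))))
  · omega
  · omega
  · omega
  · have he : e = 1 := by omega
    exact Or.inr (Or.inr (Or.inr (Or.inr (Or.inr (Or.inr (Or.inr (Or.inr (Or.inr (Or.inr (Or.inr (Or.inr (Or.inr (Or.inr (Or.inr (Or.inr (Or.inr (Or.inl ⟨rfl, rfl, he⟩)))))))))))))))))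
  · omega
  · omega
  · omega
  · have he : e = 6 := by omega
    exact Or.inr (Or.inr (Or.inr (Or.inr (Or.inr (Or.inr (Or.inr (Or.inr (Or.inr (Or.inr (Or.inr (Or.inr (Or.inr (Or.inr (Or.inr (Or.inr (Or.inr (Or.inr (Or.inl ⟨rfl, rfl, he⟩))))))))))))))))))
  · have he : e = 3 := by omega
    exact Or.inr (Or.inr (Or.inr (Or.inr (Or.inr (Or.inr (Or.inr (Or.inr (Or.inr (Or.inr (Or.inr (Or.inr (Or.inr (Or.inr (Or.inr (Or.inr (Or.inr (Or.inr (Or.inr (Or.inl ⟨rfl, rfl, he⟩)))))))))))))))))))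
  · have he : e = 2 := by omega
    exact Or.inr (Or.inr (Or.inr (Or.inr (Or.inr (Or.inr (Or.inr (Or.inr (Or.inr (Or.inr (Or.inr (Or.inr (Or.inr (Or.inr (Or.inr (Or.inr (Or.inr (Or.inr (Or.inr (Or.inr (Or.inl ⟨rfl, rfl, he⟩))))))))))))))))))))
  · have he : e = 1 := by omega
    exact Or.inr (Or.inr (Or.inr (Or.inr (Or.inr (Or.inr (Or.inr (Or.inr (Or.inr (Or.inr (Or.inr (Or.inr (Or.inr (Or.inr (Or.inr (Or.inr (Or.inr (Or.inr (Or.inr (Or.inr (Or.inr (Or.inl ⟨rfl, rfl, he⟩)))))))))))))))))))))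
  · omega
  · omega
  · omega
  · omega
  · have he : e = 3 := by omega
    exact Or.inr (Or.inr (Or.inr (Or.inr (Or.inr (Or.inr (Or.inr (Or.inr (Or.inr (Or.inr (Or.inr (Or.inr (Or.inr (Or.inr (Or.inr (Or.inr (Or.inr (Or.inr (Or.inr (Or.inr (Or.inr (Or.inr (Or.inl ⟨rfl, rfl, he⟩))))))))))))))))))))))
  · omega
  · have he : e = 1 := by omega
    exact Or.inr (Or.inr (Or.inr (Or.inr (Or.inr (Or.inr (Or.inr (Or.inr (Or.inr (Or.inr (Or.inr (Or.inr (Or.inr (Or.inr (Or.inr (Or.inr (Or.inr (Or.inr (Or.inr (Or.inr (Or.inr (Or.inr (Or.inr (Or.inl ⟨rfl, rfl, he⟩)))))))))))))))))))))))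
  · omega
  · omega
  · omega
  · omega
  · omega
  · have he : e = 2 := by omega
    exact Or.inr (Or.inr (Or.inr (Or.inr (Or.inr (Or.inr (Or.inr (Or.inr (Or.inr (Or.inr (Or.inr (Or.inr (Or.inr (Or.inr (Or.inr (Or.inr (Or.inr (Or.inr (Or.inr (Or.inr (Or.inr (Or.inr (Or.inr (Or.inr (Or.inl ⟨rfl, rfl, he⟩))))))))))))))))))))))))
  · have he : e = 1 := by omega
    exact Or.inr (Or.inr (Or.inr (Or.inr (Or.inr (Or.inr (Or.inr (Or.inr (Or.inr (Or.inr (Or.inr (Or.inr (Or.inr (Or.inr (Or.inr (Or.inr (Or.inr (Or.inr (Or.inr (Or.inr (Or.inr (Or.inr (Or.inr (Or.inr (Or.inr (Or.inl ⟨rfl, rfl, he⟩)))))))))))))))))))))))))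
  · omega
  · omega
  · omega
  · omega
  · omega
  · omega
  · have he : e = 1 := by omega
    exact Or.inr (Or.inr (Or.inr (Or.inr (Or.inr (Or.inr (Or.inr (Or.inr (Or.inr (Or.inr (Or.inr (Or.inr (Or.inr (Or.inr (Or.inr (Or.inr (Or.inr (Or.inr (Or.inr (Or.inr (Or.inr (Or.inr (Or.inr (Or.inr (Or.inr (Or.inr (⟨rfl, rfl, he⟩))))))))))))))))))))))))))
  · omega
  · omega
  · omega
  · omega
  · omega
  · omega
  · omega

end Summit.MatrixMultiplication.OmegaCensus
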